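import Summits.ResolutionOfSingularities.ResolutionOfSingularities.Theorems.PurelyInseparableDim4BinomialCensusRootsA
import Summits.ResolutionOfSingularities.ResolutionOfSingularities.Theorems.PurelyInseparableDim4BinomialCensusRootsB
import Summits.ResolutionOfSingularities.ResolutionOfSingularities.Theorems.PurelyInseparableDim4BinomialCensusRootsC
import HarnessLib

/-!
# [OURS · res-dim4-pi · F4-C-loc] THE BINOMIAL CLASS of the (3,3) LOCAL census is COVERED by the certified roots:
  the `S₄`-images of the 3,782 kernel-certified census roots exhaust every admissible two-monomial triple `(a, b, c)`

Cell `res-dim4-pi` (D-0157 DOOR 2, wave 2), seat `res-dim4-p-6` g5, desk WORD #210 (b); the computable layer and the ONE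
`decide +kernel` of the «binomial class theorem» (`…BinomialClassLocalWin`).  §1 the class of record as computable data
(g3 `census.py gen_roots`: exponent lists in `{0,…,3}⁴` with total degree `≥ 3` and not a cube monomial — `expsOK`, 226
lists; units `c ∈ {1, 2}`; ordered pairs `a ≠ b`), base-4 keys `key a b c = ofDigits 4 (c :: a ++ b)`, the 24 index lists
`permIdx`, the binomial `shape` of a certified root (`⟨[(u,1),(v,c)], 0, ∅⟩` with exponents `≤ 3`), the bitmask `cover` of
the keys of all `S₄`-images of all certified roots (`allRoots` = aggregators A ++ B ++ C, 3,597 + 185 presented states),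
and the class check `classOK` (every admissible triple hits `cover` in one of its two orderings — the other ordering is the
unit-scalar image, see the headline file); **`classOK_true`** by `decide +kernel` (3,782 × 24 mask bits, then the 25,425 unordered
pairs of the 226 admissible exponent lists × 2 units × 2 orderings; hub-farm scratch timing with the 185 already-built roots: mask 0.5 s + full class pass 6.4 s, i.e. ≈ 20 s projected
for all 3,782 roots — rider (iii); the gate's measured elaboration seconds of THIS file are posted on the cell bus at landing).
§2 the
elementary bridges: set bits of `bits`/`unionAll` come from members, **`exists_of_testBit_cover`**, base-4 **`key_inj`**
(`Nat.ofDigits_inj_of_len_eq`), **`exists_perm_of_mem_permIdx`** (the 24 index lists as explicit `Equiv.Perm (Fin 4)` acting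
on exponent functions), **`eq_of_shape`**, and §3 the reading of the check at one admissible triple
(**`covered_of_classBody`**, `toL_mem_expsOK`).  A Python replica of the same check (same keys, same class) passed
101,700 / 101,700 triples before filing.

[OURS · counted 0 · bookkeeping + one kernel computation about OUR finite certificate set; AI kernel work, weaker than expert
review.]  NOTHING here is a statement about resolution of singularities; resolution in dimension `≥ 4` / characteristic
`p > 0` is NOT proved by anything in this file.  bears_on: LADDER-RESOLUTION:D157-DOOR2 (res-dim4-pi · (3,3) LOCAL binomial
class · coverage).  Host item (DR-157-C): `stmt-ResolutionOfSingularities-16155`, helper.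
-/

set_option linter.dupNamespace false -- mandated namespace of this single-conjunct summit

noncomputable section

open MvPolynomial Finset

namespace Summit.ResolutionOfSingularities.ResolutionOfSingularities.Theorems.PIDim4

namespace LoopCLocal

open StepKit BinomialCensus

namespace BinomialClass

/-! ## §1 The computable layer: keys, permutations, the cover mask, the class check -/

/-- the four admissible single exponents. [OURS · data] -/
def digs : List ℕ := [0, 1, 2, 3]

/-- all `4⁴` exponent lists. [OURS · data] -/
def exps : List (List ℕ) :=
  digs.flatMap fun a0 => digs.flatMap fun a1 => digs.flatMap fun a2 => digs.map fun a3 => [a0, a1, a2, a3]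

/-- the class condition on one exponent list: total degree `≥ 3`, not a cube monomial. [OURS] -/
def okE (e : List ℕ) : Bool := decide (3 ≤ e.sum) && !(e.all fun x => x % 3 == 0)

/-- the admissible exponent lists (226 of them). [OURS · data] -/
def expsOK : List (List ℕ) := exps.filter fun e => okE e

/-- base-4 key of a triple `(a, b, c)`: digits `c, a₀, …, a₃, b₀, …, b₃` (the semantic key). [OURS] -/
def key (a b : List ℕ) (c : ℕ) : ℕ := Nat.ofDigits 4 (c :: (a ++ b))

/-- the same key from the base-4 values `A`, `B` of the two exponent lists (the computed key). [OURS] -/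
def keyN (A B c : ℕ) : ℕ := c + 4 * (A + 256 * B)

/-- the admissible exponent lists paired with their base-4 values. [OURS · data] -/
def expsOKN : List (List ℕ × ℕ) := expsOK.map fun a => (a, Nat.ofDigits 4 a)

/-- the 24 index lists of the permutations of four letters. [OURS · data] -/
def permIdx : List (List ℕ) :=
  [[0, 1, 2, 3], [0, 1, 3, 2], [0, 2, 1, 3], [0, 2, 3, 1], [0, 3, 1, 2], [0, 3, 2, 1],
   [1, 0, 2, 3], [1, 0, 3, 2], [1, 2, 0, 3], [1, 2, 3, 0], [1, 3, 0, 2], [1, 3, 2, 0],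
   [2, 0, 1, 3], [2, 0, 3, 1], [2, 1, 0, 3], [2, 1, 3, 0], [2, 3, 0, 1], [2, 3, 1, 0],
   [3, 0, 1, 2], [3, 0, 2, 1], [3, 1, 0, 2], [3, 1, 2, 0], [3, 2, 0, 1], [3, 2, 1, 0]]

/-- apply an index list to a list: `[l[σ₀], l[σ₁], …]`. [OURS] -/
def app (σ l : List ℕ) : List ℕ := σ.map fun i => l.getD i 0

/-- the 4-list of an exponent function. [OURS] -/
def toL (u : Fin 4 → ℕ) : List ℕ := [u 0, u 1, u 2, u 3]

/-- **the keys of the 24 `S₄`-images of a root `x^u + c·x^v`, as explicit base-4 formulas** (what the kernel evaluates;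
`keys24_eq` identifies them with `key (app σ (toL u)) (app σ (toL v)) c`, `σ ∈ permIdx`). [OURS] -/
def keys24 (u0 u1 u2 u3 v0 v1 v2 v3 c : ℕ) : List ℕ :=
  [c + 4 * (u0 + 4 * (u1 + 4 * (u2 + 4 * (u3 + 4 * (v0 + 4 * (v1 + 4 * (v2 + 4 * (v3 + 4 * 0)))))))),
   c + 4 * (u0 + 4 * (u1 + 4 * (u3 + 4 * (u2 + 4 * (v0 + 4 * (v1 + 4 * (v3 + 4 * (v2 + 4 * 0)))))))),
   c + 4 * (u0 + 4 * (u2 + 4 * (u1 + 4 * (u3 + 4 * (v0 + 4 * (v2 + 4 * (v1 + 4 * (v3 + 4 * 0)))))))),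
   c + 4 * (u0 + 4 * (u2 + 4 * (u3 + 4 * (u1 + 4 * (v0 + 4 * (v2 + 4 * (v3 + 4 * (v1 + 4 * 0)))))))),
   c + 4 * (u0 + 4 * (u3 + 4 * (u1 + 4 * (u2 + 4 * (v0 + 4 * (v3 + 4 * (v1 + 4 * (v2 + 4 * 0)))))))),
   c + 4 * (u0 + 4 * (u3 + 4 * (u2 + 4 * (u1 + 4 * (v0 + 4 * (v3 + 4 * (v2 + 4 * (v1 + 4 * 0)))))))),
   c + 4 * (u1 + 4 * (u0 + 4 * (u2 + 4 * (u3 + 4 * (v1 + 4 * (v0 + 4 * (v2 + 4 * (v3 + 4 * 0)))))))),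
   c + 4 * (u1 + 4 * (u0 + 4 * (u3 + 4 * (u2 + 4 * (v1 + 4 * (v0 + 4 * (v3 + 4 * (v2 + 4 * 0)))))))),
   c + 4 * (u1 + 4 * (u2 + 4 * (u0 + 4 * (u3 + 4 * (v1 + 4 * (v2 + 4 * (v0 + 4 * (v3 + 4 * 0)))))))),
   c + 4 * (u1 + 4 * (u2 + 4 * (u3 + 4 * (u0 + 4 * (v1 + 4 * (v2 + 4 * (v3 + 4 * (v0 + 4 * 0)))))))),
   c + 4 * (u1 + 4 * (u3 + 4 * (u0 + 4 * (u2 + 4 * (v1 + 4 * (v3 + 4 * (v0 + 4 * (v2 + 4 * 0)))))))),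
   c + 4 * (u1 + 4 * (u3 + 4 * (u2 + 4 * (u0 + 4 * (v1 + 4 * (v3 + 4 * (v2 + 4 * (v0 + 4 * 0)))))))),
   c + 4 * (u2 + 4 * (u0 + 4 * (u1 + 4 * (u3 + 4 * (v2 + 4 * (v0 + 4 * (v1 + 4 * (v3 + 4 * 0)))))))),
   c + 4 * (u2 + 4 * (u0 + 4 * (u3 + 4 * (u1 + 4 * (v2 + 4 * (v0 + 4 * (v3 + 4 * (v1 + 4 * 0)))))))),
   c + 4 * (u2 + 4 * (u1 + 4 * (u0 + 4 * (u3 + 4 * (v2 + 4 * (v1 + 4 * (v0 + 4 * (v3 + 4 * 0)))))))),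
   c + 4 * (u2 + 4 * (u1 + 4 * (u3 + 4 * (u0 + 4 * (v2 + 4 * (v1 + 4 * (v3 + 4 * (v0 + 4 * 0)))))))),
   c + 4 * (u2 + 4 * (u3 + 4 * (u0 + 4 * (u1 + 4 * (v2 + 4 * (v3 + 4 * (v0 + 4 * (v1 + 4 * 0)))))))),
   c + 4 * (u2 + 4 * (u3 + 4 * (u1 + 4 * (u0 + 4 * (v2 + 4 * (v3 + 4 * (v1 + 4 * (v0 + 4 * 0)))))))),
   c + 4 * (u3 + 4 * (u0 + 4 * (u1 + 4 * (u2 + 4 * (v3 + 4 * (v0 + 4 * (v1 + 4 * (v2 + 4 * 0)))))))),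
   c + 4 * (u3 + 4 * (u0 + 4 * (u2 + 4 * (u1 + 4 * (v3 + 4 * (v0 + 4 * (v2 + 4 * (v1 + 4 * 0)))))))),
   c + 4 * (u3 + 4 * (u1 + 4 * (u0 + 4 * (u2 + 4 * (v3 + 4 * (v1 + 4 * (v0 + 4 * (v2 + 4 * 0)))))))),
   c + 4 * (u3 + 4 * (u1 + 4 * (u2 + 4 * (u0 + 4 * (v3 + 4 * (v1 + 4 * (v2 + 4 * (v0 + 4 * 0)))))))),
   c + 4 * (u3 + 4 * (u2 + 4 * (u0 + 4 * (u1 + 4 * (v3 + 4 * (v2 + 4 * (v0 + 4 * (v1 + 4 * 0)))))))),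
   c + 4 * (u3 + 4 * (u2 + 4 * (u1 + 4 * (u0 + 4 * (v3 + 4 * (v2 + 4 * (v1 + 4 * (v0 + 4 * 0))))))))]

/-- the binomial shape of a presented root: `(toL u, toL v, c.val)` when `s = ⟨[(u, 1), (v, c)], 0, ∅⟩` with exponents
`≤ 3`, else `none`. [OURS] -/
def shape : SData 4 (ZMod 3) → Option (List ℕ × List ℕ × ℕ)
  | ⟨[(u, cu), (v, cv)], r, exc⟩ =>
      if cu = 1 ∧ toL r = [0, 0, 0, 0] ∧ exc = ∅ ∧ (∀ x ∈ toL u, x ≤ 3) ∧ (∀ x ∈ toL v, x ≤ 3) then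
        some (toL u, toL v, cv.val) else none
  | _ => none

/-- bitmask of a list of bit positions. [OURS] -/
def bits : List ℕ → ℕ
  | [] => 0
  | k :: l => 2 ^ k ||| bits l

/-- bitwise union of a list of masks. [OURS] -/
def unionAll : List ℕ → ℕ
  | [] => 0
  | m :: l => m ||| unionAll l

/-- all certified census roots (aggregators A, B, C: 3,597 + 185 presented states). [OURS · data] -/
def allRoots : List (SData 4 (ZMod 3)) := rootsA ++ (rootsB ++ rootsC)

/-- their binomial shapes. [OURS · data] -/
def shapes : List (List ℕ × List ℕ × ℕ) := allRoots.filterMap shape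

/-- the mask of the 24 `S₄`-images of one shape (`0` off the 4-list format). [OURS] -/
def coverOf : List ℕ × List ℕ × ℕ → ℕ
  | ([u0, u1, u2, u3], [v0, v1, v2, v3], c) => bits (keys24 u0 u1 u2 u3 v0 v1 v2 v3 c)
  | _ => 0

/-- **the cover mask**: bit `key (σ·u) (σ·v) c` set for every certified root `x^u + c·x^v` and every `σ ∈ S₄`. [OURS] -/
def cover : ℕ := unionAll (shapes.map coverOf)

/-- one unordered pair of admissible lists against a mask `m`: both units, either ordering. [OURS] -/
def cov (m : ℕ) (x y : List ℕ × ℕ) : Bool :=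
  (m.testBit (keyN x.2 y.2 1) || m.testBit (keyN y.2 x.2 1)) &&
    (m.testBit (keyN x.2 y.2 2) || m.testBit (keyN y.2 x.2 2))

/-- all unordered pairs of a list pass `cov m`. [OURS] -/
def pairsOK (m : ℕ) : List (List ℕ × ℕ) → Bool
  | [] => true
  | x :: rest => rest.all (cov m x) && pairsOK m rest

/-- the class check against a mask `m`. [OURS] -/
def classBody (m : ℕ) : Bool := pairsOK m expsOKN

/-- the class check against `cover` (the `match` makes the kernel evaluate the mask once). [OURS] -/
def classOK : Bool :=
  match cover with
  | 0 => false
  | m + 1 => classBody (m + 1)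

/-- **THE COVERAGE CHECK** (kernel: 3,782 roots × 24 key formulas into one mask, then the 25,425 unordered pairs of the 226
admissible exponent lists × 2 units × 2 orderings against it). [OURS · ‖ K] -/
theorem classOK_true : classOK = true := by
  decide +kernel

/-- hence the class check against `cover` itself. [OURS] -/
theorem classBody_cover : classBody cover = true := by
  have h := classOK_true
  unfold classOK at h
  split at h
  · exact absurd h Bool.false_ne_true
  · next m hm => rw [hm]; exact h

/-! ## §2 Bridges: bitmasks, keys, permutations, shapes -/

/-- a set bit of `bits l` is a listed position. [OURS] -/
theorem mem_of_testBit_bits {l : List ℕ} {k : ℕ} (h : (bits l).testBit k = true) : k ∈ l := by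
  induction l with
  | nil => simp [bits, Nat.zero_testBit] at h
  | cons x l ih =>
    rw [bits, Nat.testBit_or, Bool.or_eq_true] at h
    rcases h with h | h
    · by_cases hx : x = k
      · exact hx ▸ List.mem_cons_self
      · rw [Nat.testBit_two_pow_of_ne hx] at h
        exact absurd h Bool.false_ne_true
    · exact List.mem_cons_of_mem _ (ih h)

/-- a set bit of a union is a set bit of a member. [OURS] -/
theorem exists_of_testBit_unionAll {L : List ℕ} {k : ℕ} (h : (unionAll L).testBit k = true) :
    ∃ m ∈ L, m.testBit k = true := by
  induction L with
  | nil => simp [unionAll, Nat.zero_testBit] at h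
  | cons m L ih =>
    rw [unionAll, Nat.testBit_or, Bool.or_eq_true] at h
    rcases h with h | h
    · exact ⟨m, List.mem_cons_self, h⟩
    · obtain ⟨m', hm', h'⟩ := ih h
      exact ⟨m', List.mem_cons_of_mem _ hm', h'⟩

/-- the explicit formulas are the keys of the 24 images. [OURS] -/
theorem keys24_eq (u v : Fin 4 → ℕ) (c : ℕ) :
    keys24 (u 0) (u 1) (u 2) (u 3) (v 0) (v 1) (v 2) (v 3) c =
      permIdx.map fun σ => key (app σ (toL u)) (app σ (toL v)) c := rfl

/-- **a covered key comes from a certified root and a permutation** (shape level). [OURS] -/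
theorem exists_of_testBit_cover {k : ℕ} (h : cover.testBit k = true) :
    ∃ t ∈ shapes, (coverOf t).testBit k = true := by
  obtain ⟨m, hm, hk⟩ := exists_of_testBit_unionAll h
  obtain ⟨t, ht, rfl⟩ := List.mem_map.mp hm
  exact ⟨t, ht, hk⟩

/-- reading `coverOf` at a genuine root shape. [OURS] -/
theorem exists_perm_of_testBit_coverOf {u v : Fin 4 → ℕ} {c k : ℕ} (h : (coverOf (toL u, toL v, c)).testBit k = true) :
    ∃ σ ∈ permIdx, key (app σ (toL u)) (app σ (toL v)) c = k := by
  have h' : (bits (keys24 (u 0) (u 1) (u 2) (u 3) (v 0) (v 1) (v 2) (v 3) c)).testBit k = true := h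
  rw [keys24_eq] at h'
  obtain ⟨σ, hσ, hkey⟩ := List.mem_map.mp (mem_of_testBit_bits h')
  exact ⟨σ, hσ, hkey⟩

/-- the computed key is the semantic key. [OURS] -/
theorem key_eq_keyN {a b : List ℕ} (c : ℕ) (ha : a.length = 4) :
    key a b c = keyN (Nat.ofDigits 4 a) (Nat.ofDigits 4 b) c := by
  simp only [key, keyN, Nat.ofDigits_cons, Nat.ofDigits_append, ha]
  ring

/-- **base-4 keys are injective** on digit lists of the right shape. [OURS] -/
theorem key_inj {a b a' b' : List ℕ} {c c' : ℕ} (h : key a b c = key a' b' c') (hc : c < 4) (hc' : c' < 4)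
    (hab : ∀ x ∈ a ++ b, x ≤ 3) (hab' : ∀ x ∈ a' ++ b', x ≤ 3) (ha : a.length = 4) (hb : b.length = 4)
    (ha' : a'.length = 4) (hb' : b'.length = 4) : c = c' ∧ a = a' ∧ b = b' := by
  have hlen : (c :: (a ++ b)).length = (c' :: (a' ++ b')).length := by
    simp only [List.length_cons, List.length_append, ha, hb, ha', hb']
  have w1 : ∀ x ∈ c :: (a ++ b), x < 4 := by
    intro x hx
    rcases List.mem_cons.mp hx with rfl | hx
    · exact hc
    · exact Nat.lt_succ_of_le (hab x hx)
  have w2 : ∀ x ∈ c' :: (a' ++ b'), x < 4 := by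
    intro x hx
    rcases List.mem_cons.mp hx with rfl | hx
    · exact hc'
    · exact Nat.lt_succ_of_le (hab' x hx)
  have hl := Nat.ofDigits_inj_of_len_eq (by norm_num) hlen w1 w2 h
  obtain ⟨rfl, htl⟩ := List.cons.inj hl
  exact ⟨rfl, List.append_inj htl (ha.trans ha'.symm)⟩

/-- **the 24 index lists are the permutations of the four letters**, as `Equiv`s acting on exponent functions. [OURS · ‖ K] -/
theorem exists_perm_of_mem_permIdx {σ : List ℕ} (h : σ ∈ permIdx) :
    ∃ e : Equiv.Perm (Fin 4), ∀ u : Fin 4 → ℕ, app σ (toL u) = toL (u ∘ ⇑e) := by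
  simp only [permIdx, List.mem_cons, List.mem_nil_iff, or_false] at h
  rcases h with rfl | rfl | rfl | rfl | rfl | rfl | rfl | rfl | rfl | rfl | rfl | rfl | rfl | rfl | rfl | rfl |
    rfl | rfl | rfl | rfl | rfl | rfl | rfl | rfl
  · exact ⟨⟨![0, 1, 2, 3], ![0, 1, 2, 3], by decide, by decide⟩, fun _ => rfl⟩
  · exact ⟨⟨![0, 1, 3, 2], ![0, 1, 3, 2], by decide, by decide⟩, fun _ => rfl⟩
  · exact ⟨⟨![0, 2, 1, 3], ![0, 2, 1, 3], by decide, by decide⟩, fun _ => rfl⟩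
  · exact ⟨⟨![0, 2, 3, 1], ![0, 3, 1, 2], by decide, by decide⟩, fun _ => rfl⟩
  · exact ⟨⟨![0, 3, 1, 2], ![0, 2, 3, 1], by decide, by decide⟩, fun _ => rfl⟩
  · exact ⟨⟨![0, 3, 2, 1], ![0, 3, 2, 1], by decide, by decide⟩, fun _ => rfl⟩
  · exact ⟨⟨![1, 0, 2, 3], ![1, 0, 2, 3], by decide, by decide⟩, fun _ => rfl⟩
  · exact ⟨⟨![1, 0, 3, 2], ![1, 0, 3, 2], by decide, by decide⟩, fun _ => rfl⟩
  · exact ⟨⟨![1, 2, 0, 3], ![2, 0, 1, 3], by decide, by decide⟩, fun _ => rfl⟩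
  · exact ⟨⟨![1, 2, 3, 0], ![3, 0, 1, 2], by decide, by decide⟩, fun _ => rfl⟩
  · exact ⟨⟨![1, 3, 0, 2], ![2, 0, 3, 1], by decide, by decide⟩, fun _ => rfl⟩
  · exact ⟨⟨![1, 3, 2, 0], ![3, 0, 2, 1], by decide, by decide⟩, fun _ => rfl⟩
  · exact ⟨⟨![2, 0, 1, 3], ![1, 2, 0, 3], by decide, by decide⟩, fun _ => rfl⟩
  · exact ⟨⟨![2, 0, 3, 1], ![1, 3, 0, 2], by decide, by decide⟩, fun _ => rfl⟩
  · exact ⟨⟨![2, 1, 0, 3], ![2, 1, 0, 3], by decide, by decide⟩, fun _ => rfl⟩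
  · exact ⟨⟨![2, 1, 3, 0], ![3, 1, 0, 2], by decide, by decide⟩, fun _ => rfl⟩
  · exact ⟨⟨![2, 3, 0, 1], ![2, 3, 0, 1], by decide, by decide⟩, fun _ => rfl⟩
  · exact ⟨⟨![2, 3, 1, 0], ![3, 2, 0, 1], by decide, by decide⟩, fun _ => rfl⟩
  · exact ⟨⟨![3, 0, 1, 2], ![1, 2, 3, 0], by decide, by decide⟩, fun _ => rfl⟩
  · exact ⟨⟨![3, 0, 2, 1], ![1, 3, 2, 0], by decide, by decide⟩, fun _ => rfl⟩
  · exact ⟨⟨![3, 1, 0, 2], ![2, 1, 3, 0], by decide, by decide⟩, fun _ => rfl⟩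
  · exact ⟨⟨![3, 1, 2, 0], ![3, 1, 2, 0], by decide, by decide⟩, fun _ => rfl⟩
  · exact ⟨⟨![3, 2, 0, 1], ![2, 3, 1, 0], by decide, by decide⟩, fun _ => rfl⟩
  · exact ⟨⟨![3, 2, 1, 0], ![3, 2, 1, 0], by decide, by decide⟩, fun _ => rfl⟩

/-- `toL` is injective. [OURS] -/
theorem toL_injective {u v : Fin 4 → ℕ} (h : toL u = toL v) : u = v := by
  simp only [toL, List.cons.injEq, and_true] at h
  funext i
  match i with
  | ⟨0, _⟩ => exact h.1
  | ⟨1, _⟩ => exact h.2.1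
  | ⟨2, _⟩ => exact h.2.2.1
  | ⟨3, _⟩ => exact h.2.2.2

/-- bounded quantification over `Fin 4` versus the 4-list. [OURS] -/
theorem forall_mem_toL {u : Fin 4 → ℕ} {P : ℕ → Prop} : (∀ x ∈ toL u, P x) ↔ ∀ i, P (u i) := by
  simp only [toL, List.mem_cons, List.mem_nil_iff, or_false, forall_eq_or_imp, forall_eq]
  constructor
  · rintro ⟨h0, h1, h2, h3⟩ i
    match i with
    | ⟨0, _⟩ => exact h0
    | ⟨1, _⟩ => exact h1
    | ⟨2, _⟩ => exact h2
    | ⟨3, _⟩ => exact h3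
  · exact fun h => ⟨h 0, h 1, h 2, h 3⟩

/-- `toL u` has length 4. [OURS] -/
theorem length_toL (u : Fin 4 → ℕ) : (toL u).length = 4 := rfl

/-- **what a shape says about its root.** [OURS] -/
theorem eq_of_shape {s : SData 4 (ZMod 3)} {t : List ℕ × List ℕ × ℕ} (h : shape s = some t) :
    ∃ (u v : Fin 4 → ℕ) (c : ZMod 3), s = ⟨[(u, 1), (v, c)], 0, ∅⟩ ∧ t = (toL u, toL v, c.val) ∧
      (∀ i, u i ≤ 3) ∧ (∀ i, v i ≤ 3) := by
  obtain ⟨L, r, exc⟩ := s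
  rcases L with _ | ⟨⟨u, cu⟩, _ | ⟨⟨v, cv⟩, _ | ⟨w, L⟩⟩⟩
  · simp [shape] at h
  · simp [shape] at h
  · simp only [shape] at h
    split_ifs at h with hcond
    obtain ⟨hcu, hr, hexc, hu, hv⟩ := hcond
    have hr0 : r = 0 := toL_injective (by rw [hr]; rfl)
    subst hcu hr0 hexc
    exact ⟨u, v, cv, rfl, (Option.some.inj h).symm, forall_mem_toL.mp hu, forall_mem_toL.mp hv⟩
  · simp [shape] at h

/-! ## §3 From the hypotheses of the class theorem to the class check -/

/-- membership in `digs`. [OURS] -/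
theorem mem_digs {x : ℕ} (h : x ≤ 3) : x ∈ digs := by
  have : ∀ y, y ≤ 3 → y ∈ digs := by decide
  exact this x h

/-- admissible exponent functions give admissible lists. [OURS] -/
theorem toL_mem_expsOK {a : Fin 4 → ℕ} (ha : ∀ i, a i ≤ 3) (ha3 : 3 ≤ ∑ i, a i) (hac : ¬ ∀ i, 3 ∣ a i) :
    toL a ∈ expsOK := by
  refine List.mem_filter.mpr ⟨?_, ?_⟩
  · simp only [exps, List.mem_flatMap, List.mem_map]
    exact ⟨a 0, mem_digs (ha 0), a 1, mem_digs (ha 1), a 2, mem_digs (ha 2), a 3, mem_digs (ha 3), rfl⟩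
  · have hsum : (toL a).sum = ∑ i, a i := by
      rw [Fin.sum_univ_four]; simp [toL, add_assoc]
    have h1 : decide (3 ≤ (toL a).sum) = true := decide_eq_true (hsum ▸ ha3)
    have h2 : ((toL a).all fun x => x % 3 == 0) = false := by
      rw [Bool.eq_false_iff]
      intro hall
      have hx : ∀ i, (a i % 3 == 0) = true := forall_mem_toL.mp (List.all_eq_true.mp hall)
      exact hac fun i => Nat.dvd_of_mod_eq_zero (beq_iff_eq.mp (hx i))
    simp only [okE, h1, h2, Bool.not_false, Bool.and_self]

/-- unordered pairs: what `pairsOK` says about two distinct members. [OURS] -/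
theorem cov_of_pairsOK {m : ℕ} {l : List (List ℕ × ℕ)} (h : pairsOK m l = true) {x y : List ℕ × ℕ} (hx : x ∈ l)
    (hy : y ∈ l) (hne : x ≠ y) : cov m x y = true ∨ cov m y x = true := by
  induction l with
  | nil => simp at hx
  | cons z rest ih =>
    rw [pairsOK, Bool.and_eq_true] at h
    rcases List.mem_cons.mp hx with rfl | hx'
    · rcases List.mem_cons.mp hy with rfl | hy'
      · exact absurd rfl hne
      · exact Or.inl (List.all_eq_true.mp h.1 y hy')
    · rcases List.mem_cons.mp hy with rfl | hy'
      · exact Or.inr (List.all_eq_true.mp h.1 x hx')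
      · exact ih h.2 hx' hy'

/-- **the class check read at one admissible triple**: its key is covered in one of the two orderings. [OURS] -/
theorem covered_of_classBody {la lb : List ℕ} (hla : la ∈ expsOK) (hlb : lb ∈ expsOK) (hne : la ≠ lb)
    (hla4 : la.length = 4) (hlb4 : lb.length = 4) {c : ℕ} (hc : c = 1 ∨ c = 2) :
    cover.testBit (key la lb c) = true ∨ cover.testBit (key lb la c) = true := by
  have hx : (la, Nat.ofDigits 4 la) ∈ expsOKN := List.mem_map.mpr ⟨la, hla, rfl⟩
  have hy : (lb, Nat.ofDigits 4 lb) ∈ expsOKN := List.mem_map.mpr ⟨lb, hlb, rfl⟩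
  have hxy : (la, Nat.ofDigits 4 la) ≠ (lb, Nat.ofDigits 4 lb) := fun h => hne (congrArg Prod.fst h)
  rw [key_eq_keyN c hla4, key_eq_keyN c hlb4]
  rcases cov_of_pairsOK classBody_cover hx hy hxy with h | h <;>
    · rw [cov, Bool.and_eq_true, Bool.or_eq_true, Bool.or_eq_true] at h
      rcases hc with rfl | rfl
      · rcases h.1 with h1 | h1
        · first | exact Or.inl h1 | exact Or.inr h1
        · first | exact Or.inr h1 | exact Or.inl h1
      · rcases h.2 with h2 | h2
        · first | exact Or.inl h2 | exact Or.inr h2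
        · first | exact Or.inr h2 | exact Or.inl h2

/-- entries of an admissible list are `≤ 3`. [OURS] -/
theorem le_three_of_mem_expsOK {l : List ℕ} (h : l ∈ expsOK) : (∀ x ∈ l, x ≤ 3) ∧ l.length = 4 := by
  have hl := (List.mem_filter.mp h).1
  simp only [exps, List.mem_flatMap, List.mem_map] at hl
  obtain ⟨a0, h0, a1, h1, a2, h2, a3, h3, rfl⟩ := hl
  have hd : ∀ y ∈ digs, y ≤ 3 := by decide
  refine ⟨?_, rfl⟩
  simp only [List.mem_cons, List.mem_nil_iff, or_false, forall_eq_or_imp, forall_eq]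
  exact ⟨hd _ h0, hd _ h1, hd _ h2, hd _ h3⟩

end BinomialClass

end LoopCLocal

end Summit.ResolutionOfSingularities.ResolutionOfSingularities.Theorems.PIDim4

end
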